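import Literature.NumberTheory.Automorphic.WhittakerTowerEquivariance
import Literature.NumberTheory.Automorphic.MirabolicAveraging
import Literature.NumberTheory.Automorphic.MirabolicCosets
import HarnessLib

/-!
# The Whittaker tower, III: the inequality chain `I^{(d-1)} ≤ I^{(d)}`

Topic `NumberTheory/Automorphic`; namespace `Literature.NumberTheory.Automorphic`. The monotonicity
at the heart of the real-point Rankin–Selberg method on `GL_n` (Jacquet–Shalika (1981), §4, proof of
Lemma (5.2)/(5.3.3); Cogdell (2004), §1.1/§2.3, with Parseval replaced by Bessel so that no
cuspidality is needed). Let `φ : GL_n(𝔸_K) → ℂ` be continuous and left `GL_n(K)`-invariant, `w ≥ 0`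
measurable and left-invariant under `N_n(𝔸_K)` and under the rational mirabolic `P_n(K)` (e.g.
`w(g) = Φ(e_n g) |det g|^σ`, by the product formula), `ν` a left-invariant
s-finite measure on `GL_n(𝔸_K)`, and for each depth `d` let `β_d` be a measurable `Q_d(K)`-covering
weight. With `Φ_d` the partial Whittaker transforms and

  `I^{(d)} = ∫ ‖Φ_d‖² w β_d dν`  (`towerIntegral`),

we prove **`I^{(d-1)} ≤ I^{(d)}`** (`towerIntegral_pred_le`, `1 ≤ d < n`):

1. unfold `β_{d-1}` to `β_d` along the representatives `s_η = diag(B_η, 1)`, `η ∈ K^d ∖ {0}`, of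
   `Q_{d-1}(K) \ Q_d(K)` (`MirabolicCosets`, `CoveringWeights.lintegral_mul_eq_lintegral_tsum_mul`);
2. bound `Σ_{η ≠ 0} ‖Φ_{d-1}(s_η x)‖²` by `μ_Y(box)⁻¹ ∫_{box} ‖Φ_d(y x)‖² dy` — Bessel's inequality on
   `Y_d(K) \ Y_d(𝔸_K)` (`ColumnGroupFourier`) and the coefficient identity
   (`whittakerDepth_pred_lowCorner_mul`) — `tsum_sq_whittakerDepth_pred_le`;
3. exchange the integrals, substitute `x ↦ y⁻¹ x` and recognise the `Y`-average of `β_d`, which may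
   be replaced by `β_d` (`MirabolicAveraging.lintegral_mul_boxAverage_eq`, ♠).

Iterating, `I^{(0)} ≤ I^{(n-1)} = ∫ ‖φ‖² w β_{n-1} dν` (`towerIntegral_zero_le`). Everything is proved.

## References

* H. Jacquet, J. A. Shalika, *On Euler products and the classification of automorphic
  representations I*, Amer. J. Math. 103 (1981), §4–§5 [JacquetShalikaAJM1981].
* J. W. Cogdell, *Analytic theory of L-functions for GL_n*, in *An Introduction to the Langlands
  Program* (2004), §1.1, §2.3 [CogdellAnalyticTheory2004].
-/

noncomputable section

open MeasureTheory Measure NumberField IsDedekindDomain Matrix Set Filter Topology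
open scoped MatrixGroups ENNReal NNReal ComplexConjugate
open Literature.MeasureTheory.Group

namespace Literature.NumberTheory.Automorphic

section Chain

variable {n : ℕ} {K : Type} [Field K] [NumberField K]
variable [MeasurableSpace (GL (Fin n) (AdeleRing (𝓞 K) K))] [BorelSpace (GL (Fin n) (AdeleRing (𝓞 K) K))]

/-! ### The pointwise Bessel bound -/

/-- `Y_d(K)`-invariance of `y ↦ Φ_d(y g)` for `φ` left `GL_n(K)`-invariant. [folklore] -/
theorem whittakerDepth_rational_colGroup_mul {φ : GL (Fin n) (AdeleRing (𝓞 K) K) → ℂ}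
    (hφK : ∀ (γ₀ : GL (Fin n) K) (x : GL (Fin n) (AdeleRing (𝓞 K) K)),
      φ (Matrix.GeneralLinearGroup.map (algebraMap K (AdeleRing (𝓞 K) K)) γ₀ * x) = φ x)
    {d : ℕ} (hd : d < n) (γ : ↥(adelicColRange n K d d)) (hγ : γ ∈ rationalColRange n K d d)
    (x : GL (Fin n) (AdeleRing (𝓞 K) K)) :
    whittakerDepth d φ ((γ : GL (Fin n) (AdeleRing (𝓞 K) K)) * x) = whittakerDepth d φ x := by
  obtain ⟨γ₀, hγ₀⟩ := (mem_rationalColRange_iff γ).1 hγ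
  have hγA : Matrix.GeneralLinearGroup.map (algebraMap K (AdeleRing (𝓞 K) K)) γ₀ ∈ adelicColRange n K d d := by
    rw [hγ₀]; exact γ.2
  have hinj : Function.Injective (algebraMap K (AdeleRing (𝓞 K) K)) :=
    NumberField.AdeleRing.algebraMap_injective (𝓞 K) K
  have hγt : γ₀ ∈ tailUnipotent n K d :=
    mem_tailUnipotent_of_map_mem hinj (unipotentColRange_le_tailUnipotent d d d hγA)
  have hγc : γ₀ ∈ cornerGL n K (d + 1) :=
    mem_cornerGL_of_map_mem hinj (unipotentColRange_le_cornerGL_succ d hγA)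
  rw [← hγ₀]
  exact whittakerDepth_mul_left_of_mem hφK hd hγt hγc x

/-- **The pointwise Bessel bound.** For `φ` continuous and left `GL_n(K)`-invariant, `1 ≤ d < n`, `x`,
and representatives `s_η = diag(B_η, 1)` with low rows `η ≠ 0`:

  `Σ_{η ≠ 0} ‖Φ_{d-1}(s_η x)‖² ≤ μ(box)⁻¹ ∫_{box} ‖Φ_d(y x)‖² dμ(y)`

(`μ = Measure.haar` on `Y_d(𝔸_K)`), in `ℝ≥0∞`: the left side is the sum over `η ≠ 0` of the squared
normalised Fourier coefficients of the continuous `Y_d(K)`-invariant function `y ↦ Φ_d(y x)`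
(`whittakerDepth_pred_lowCorner_mul`), bounded by Bessel's inequality (`tsum_norm_sq_boxCoeff_le`).
[folklore] -/
theorem tsum_sq_whittakerDepth_pred_le {φ : GL (Fin n) (AdeleRing (𝓞 K) K) → ℂ} (hφ : Continuous φ)
    (hφK : ∀ (γ₀ : GL (Fin n) K) (x : GL (Fin n) (AdeleRing (𝓞 K) K)),
      φ (Matrix.GeneralLinearGroup.map (algebraMap K (AdeleRing (𝓞 K) K)) γ₀ * x) = φ x)
    {d : ℕ} (hd : d < n) (hd0 : 0 < d)
    (B : {η : ColIdx n d → K // η ≠ 0} → GL (ColIdx n d) K)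
    (hB : ∀ η, lowRow d (lowCornerGL (n := n) (R := K) d (B η)) = η.1)
    (x : GL (Fin n) (AdeleRing (𝓞 K) K)) :
    ∑' η : {η : ColIdx n d → K // η ≠ 0},
        ENNReal.ofReal (‖whittakerDepth (d - 1) φ
          (Matrix.GeneralLinearGroup.map (algebraMap K (AdeleRing (𝓞 K) K)) (lowCornerGL (n := n) (R := K) d (B η)) * x)‖ ^ 2) ≤
      ((Measure.haar (G := ↥(adelicColRange n K d d))) (colRangeTateDomain n K d d))⁻¹ *
        ∫⁻ y in colRangeTateDomain n K d d,
          ENNReal.ofReal (‖whittakerDepth d φ ((y : GL (Fin n) (AdeleRing (𝓞 K) K)) * x)‖ ^ 2)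
          ∂(Measure.haar (G := ↥(adelicColRange n K d d))) := by
  -- auxiliary Borel structures for the Fourier analysis on `(𝔸_K ⧸ K)^d`
  letI : MeasurableSpace (AdeleRing (𝓞 K) K) := borel _
  haveI : BorelSpace (AdeleRing (𝓞 K) K) := ⟨rfl⟩
  letI : MeasurableSpace (adeleQuotient K) := borel _
  haveI : BorelSpace (adeleQuotient K) := ⟨rfl⟩
  set Y := adelicColRange n K d d with hY
  set μ : Measure ↥Y := Measure.haar with hμ
  set box := colRangeTateDomain n K d d with hbox
  set V := μ box with hV
  have hV0 : V ≠ 0 := (measure_colRangeTateDomain_pos_of_isHaarMeasure μ).ne'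
  have hVtop : V ≠ ⊤ := (measure_colRangeTateDomain_lt_top μ).ne
  have hVr : 0 < V.toReal := ENNReal.toReal_pos hV0 hVtop
  -- the function on `Y` and its invariance
  set Fx : ↥Y → ℂ := fun y => whittakerDepth d φ ((y : GL (Fin n) (AdeleRing (𝓞 K) K)) * x) with hFx
  have hFxc : Continuous Fx := (continuous_whittakerDepth hφ d).comp (continuous_subtype_val.mul continuous_const)
  have hFxinv : ∀ γ : ↥Y, γ ∈ rationalColRange n K d d → ∀ y, Fx (γ * y) = Fx y := by
    intro γ hγ y
    simp only [hFx, Subgroup.coe_mul, mul_assoc]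
    exact whittakerDepth_rational_colGroup_mul hφK hd γ hγ _
  obtain ⟨hsum, hle⟩ := tsum_norm_sq_boxCoeff_le d hd μ hFxc hFxinv
  -- the coefficients at `η ≠ 0` are the values `Φ_{d-1}(s_η x)`
  set coef : (ColIdx n d → K) → ℝ := fun η => ‖(V.toReal)⁻¹ •
      ∫ y in box, conj (colChar (n := n) (K := K) d hd η y : ℂ) * Fx y ∂μ‖ ^ 2 with hcoef
  have hcoef_eq : ∀ η : {η : ColIdx n d → K // η ≠ 0},
      ‖whittakerDepth (d - 1) φ
        (Matrix.GeneralLinearGroup.map (algebraMap K (AdeleRing (𝓞 K) K)) (lowCornerGL (n := n) (R := K) d (B η)) * x)‖ ^ 2 =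
        coef η.1 := by
    intro η
    rw [hcoef, whittakerDepth_pred_lowCorner_mul hφK hd hd0 η.1 (B η) (hB η) x]
  have hnn : ∀ η, 0 ≤ coef η := fun η => by positivity
  -- real inequality
  have hreal : ∑' η : {η : ColIdx n d → K // η ≠ 0}, coef η.1 ≤ (V.toReal)⁻¹ * ∫ y in box, ‖Fx y‖ ^ 2 ∂μ :=
    (Summable.tsum_subtype_le coef {η | η ≠ 0} hnn hsum).trans hle
  -- pass to `ℝ≥0∞`
  have hsum' : Summable fun η : {η : ColIdx n d → K // η ≠ 0} => coef η.1 := hsum.subtype _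
  calc ∑' η : {η : ColIdx n d → K // η ≠ 0},
        ENNReal.ofReal (‖whittakerDepth (d - 1) φ
          (Matrix.GeneralLinearGroup.map (algebraMap K (AdeleRing (𝓞 K) K)) (lowCornerGL (n := n) (R := K) d (B η)) * x)‖ ^ 2)
      = ∑' η : {η : ColIdx n d → K // η ≠ 0}, ENNReal.ofReal (coef η.1) := by
        refine tsum_congr fun η => ?_; rw [hcoef_eq]
    _ = ENNReal.ofReal (∑' η : {η : ColIdx n d → K // η ≠ 0}, coef η.1) :=
        (ENNReal.ofReal_tsum_of_nonneg (fun η => hnn _) hsum').symm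
    _ ≤ ENNReal.ofReal ((V.toReal)⁻¹ * ∫ y in box, ‖Fx y‖ ^ 2 ∂μ) := ENNReal.ofReal_le_ofReal hreal
    _ = V⁻¹ * ∫⁻ y in box, ENNReal.ofReal (‖Fx y‖ ^ 2) ∂μ := by
        rw [ENNReal.ofReal_mul (inv_nonneg.2 hVr.le), ENNReal.ofReal_inv_of_pos hVr, ENNReal.ofReal_toReal hVtop]
        congr 1
        -- integrability of the continuous `‖Fx‖²` on the box (compact closure, finite Haar measure)
        have hint : IntegrableOn (fun y => ‖Fx y‖ ^ 2) box μ :=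
          ((hFxc.norm.pow 2).continuousOn.integrableOn_compact isCompact_closure_colRangeTateDomain).mono_set
            subset_closure
        rw [ofReal_integral_eq_lintegral_ofReal hint (Eventually.of_forall fun y => by positivity)]

/-! ### The chain step -/

/-- The integrand `F_d = ‖Φ_d‖² w` of the tower integral. [folklore] -/
def towerFun (d : ℕ) (φ : GL (Fin n) (AdeleRing (𝓞 K) K) → ℂ) (w : GL (Fin n) (AdeleRing (𝓞 K) K) → ℝ≥0∞)
    (g : GL (Fin n) (AdeleRing (𝓞 K) K)) : ℝ≥0∞ :=
  ENNReal.ofReal (‖whittakerDepth d φ g‖ ^ 2) * w g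

/-- Measurability of `F_d` for continuous `φ` and measurable `w`. [folklore] -/
theorem measurable_towerFun (d : ℕ) {φ : GL (Fin n) (AdeleRing (𝓞 K) K) → ℂ} (hφ : Continuous φ)
    {w : GL (Fin n) (AdeleRing (𝓞 K) K) → ℝ≥0∞} (hw : Measurable w) : Measurable (towerFun d φ w) :=
  (ENNReal.measurable_ofReal.comp ((continuous_whittakerDepth hφ d).norm.pow 2).measurable).mul hw

/-- **`F_d` is left-invariant under `Q_d(K)`** (for `d < n`, `φ` left `GL_n(K)`-invariant, `w` left
`N_n(𝔸_K)`- and left `P_n(K)`-invariant): `Q_d(K) = P_{d+1}(K) U_{[d+1,n-1]}(K)`; `|Φ_d|` is invariant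
under both (`whittakerDepth_mul_left_of_mem`, `norm_whittakerDepth_colRange_mul`) and `Q_d(K) ≤ P_n(K)`.
[folklore] -/
theorem towerFun_ratPoints_mul {d : ℕ} (hd : d < n) {φ : GL (Fin n) (AdeleRing (𝓞 K) K) → ℂ}
    (hφK : ∀ (γ₀ : GL (Fin n) K) (x : GL (Fin n) (AdeleRing (𝓞 K) K)),
      φ (Matrix.GeneralLinearGroup.map (algebraMap K (AdeleRing (𝓞 K) K)) γ₀ * x) = φ x)
    {w : GL (Fin n) (AdeleRing (𝓞 K) K) → ℝ≥0∞}
    (hwK : ∀ γ₀ : GL (Fin n) K, γ₀ ∈ tailUnipotent n K (n - 1) →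
      ∀ x, w (Matrix.GeneralLinearGroup.map (algebraMap K (AdeleRing (𝓞 K) K)) γ₀ * x) = w x)
    (γ : ↥(ratPoints (tailUnipotent n K d))) (x : GL (Fin n) (AdeleRing (𝓞 K) K)) :
    towerFun d φ w ((γ : GL (Fin n) (AdeleRing (𝓞 K) K)) * x) = towerFun d φ w x := by
  obtain ⟨γ₀, hγ₀, hγ₀e⟩ := (mem_ratPoints_iff _ _).1 γ.2
  -- decompose `γ₀ = p u` with `p ∈ P_{d+1}(K)`, `u ∈ U_{[d+1,n-1]}(K)`
  set E := tailCornerEquiv (n := n) (R := K) d (d + 1) n (by omega) (by omega) (by omega) with hE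
  set q : ↥(tailUnipotent n K d ⊓ cornerGL n K n) := ⟨γ₀, Subgroup.mem_inf.2 ⟨hγ₀, mem_cornerGL_of_le le_rfl _⟩⟩ with hq
  have hdec : ((E q).1 : GL (Fin n) K) * ((E q).2 : GL (Fin n) K) = γ₀ := tailCornerEquiv_mul _ _ _ q
  obtain ⟨hpt, hpc⟩ := Subgroup.mem_inf.1 (E q).1.2
  have hu := (E q).2.2
  unfold towerFun
  rw [← hγ₀e, ← hdec, map_mul, mul_assoc]
  congr 1
  · rw [whittakerDepth_mul_left_of_mem hφK hd hpt hpc,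
      norm_whittakerDepth_colRange_mul hφK hd (map_mem_unipotentColRange _ hu)]
  · rw [← mul_assoc, ← map_mul, hdec]
    exact hwK γ₀ (tailUnipotent_mono (by omega) hγ₀) x

/-- **`F_d` is left-invariant under `U_{[d+1,n-1]}(𝔸_K)`.** [folklore] -/
theorem towerFun_colRange_mul {d : ℕ} (hd : d < n) {φ : GL (Fin n) (AdeleRing (𝓞 K) K) → ℂ}
    (hφK : ∀ (γ₀ : GL (Fin n) K) (x : GL (Fin n) (AdeleRing (𝓞 K) K)),
      φ (Matrix.GeneralLinearGroup.map (algebraMap K (AdeleRing (𝓞 K) K)) γ₀ * x) = φ x)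
    {w : GL (Fin n) (AdeleRing (𝓞 K) K) → ℝ≥0∞}
    (hwU : ∀ u : GL (Fin n) (AdeleRing (𝓞 K) K), u ∈ upperUnitriangular (Fin n) (AdeleRing (𝓞 K) K) → ∀ x, w (u * x) = w x)
    (u : ↥(adelicColRange n K (d + 1) (n - 1))) (x : GL (Fin n) (AdeleRing (𝓞 K) K)) :
    towerFun d φ w ((u : GL (Fin n) (AdeleRing (𝓞 K) K)) * x) = towerFun d φ w x := by
  unfold towerFun
  rw [norm_whittakerDepth_colRange_mul hφK hd u.2,
    hwU _ (unipotentColRange_le_upperUnitriangular u.2) x]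

omit [MeasurableSpace (GL (Fin n) (AdeleRing (𝓞 K) K))] [BorelSpace (GL (Fin n) (AdeleRing (𝓞 K) K))] in
/-- `Y_d(𝔸_K) ≤ P_n(𝔸_K)`: `w` is invariant under the column group. [folklore] -/
theorem colGroup_le_tailUnipotent_pred (d : ℕ) :
    adelicColRange n K d d ≤ tailUnipotent n (AdeleRing (𝓞 K) K) (n - 1) :=
  unipotentColRange_le_tailUnipotent _ _ _

/-- **The chain step `I^{(d-1)} ≤ I^{(d)}`.** Let `1 ≤ d < n`, `φ` continuous and left
`GL_n(K)`-invariant, `w ≥ 0` measurable, left `N_n(𝔸_K)`- and left `P_n(K)`-invariant, `ν` s-finite and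
left-invariant,
`β` a measurable `Q_d(K)`-covering weight and `β'` a measurable `Q_{d-1}(K)`-covering weight. Then
`∫ ‖Φ_{d-1}‖² w β' dν ≤ ∫ ‖Φ_d‖² w β dν`. [folklore] -/
theorem towerIntegral_pred_le {φ : GL (Fin n) (AdeleRing (𝓞 K) K) → ℂ} (hφ : Continuous φ)
    (hφK : ∀ (γ₀ : GL (Fin n) K) (x : GL (Fin n) (AdeleRing (𝓞 K) K)),
      φ (Matrix.GeneralLinearGroup.map (algebraMap K (AdeleRing (𝓞 K) K)) γ₀ * x) = φ x)
    {w : GL (Fin n) (AdeleRing (𝓞 K) K) → ℝ≥0∞} (hw : Measurable w)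
    (hwU : ∀ u : GL (Fin n) (AdeleRing (𝓞 K) K), u ∈ upperUnitriangular (Fin n) (AdeleRing (𝓞 K) K) → ∀ x, w (u * x) = w x)
    (hwK : ∀ γ₀ : GL (Fin n) K, γ₀ ∈ tailUnipotent n K (n - 1) →
      ∀ x, w (Matrix.GeneralLinearGroup.map (algebraMap K (AdeleRing (𝓞 K) K)) γ₀ * x) = w x)
    (ν : Measure (GL (Fin n) (AdeleRing (𝓞 K) K))) [SFinite ν] [ν.IsMulLeftInvariant]
    {d : ℕ} (hd : d < n) (hd0 : 0 < d)
    {β : GL (Fin n) (AdeleRing (𝓞 K) K) → ℝ≥0∞} (hβm : Measurable β)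
    (hβ : ∀ x, coveringSum ↥(ratPoints (tailUnipotent n K d)) β x = 1)
    {β' : GL (Fin n) (AdeleRing (𝓞 K) K) → ℝ≥0∞} (hβ'm : Measurable β')
    (hβ' : ∀ x, coveringSum ↥(ratPoints (tailUnipotent n K (d - 1))) β' x = 1) :
    ∫⁻ x, towerFun (d - 1) φ w x * β' x ∂ν ≤ ∫⁻ x, towerFun d φ w x * β x ∂ν := by
  haveI := secondCountableTopology_generalLinearGroup_adeleRing K (Fin n)
  set ι := algebraMap K (AdeleRing (𝓞 K) K) with hι
  set Y := adelicColRange n K d d with hY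
  set μ : Measure ↥Y := Measure.haar with hμ
  set box := colRangeTateDomain n K d d with hbox
  set V := μ box with hV
  have hV0 : V ≠ 0 := (measure_colRangeTateDomain_pos_of_isHaarMeasure μ).ne'
  have hVtop : V ≠ ⊤ := (measure_colRangeTateDomain_lt_top μ).ne
  -- Step 1: unfold `β'` to `β` along the representatives `s_η`
  have hdn : d - 1 < n := by omega
  set Bc := lowCornerChoice (n := n) (F := K) hd0 hdn with hBc
  set s : {η : ColIdx n d → K // η ≠ 0} → GL (Fin n) (AdeleRing (𝓞 K) K) :=
    fun η => Matrix.GeneralLinearGroup.map ι (lowCornerGL (n := n) (R := K) d (Bc η)) with hs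
  have hsΓ : ∀ η, s η ∈ ratPoints (tailUnipotent n K d) := fun η =>
    Subgroup.mem_map_of_mem _ (cornerGL_le_tailUnipotent d (lowCornerGL_mem_cornerGL d (Bc η)))
  have hsU : ∀ γ ∈ ratPoints (tailUnipotent n K d), ∃! η, γ * (s η)⁻¹ ∈ ratPoints (tailUnipotent n K (d - 1)) := by
    intro γ hγ
    obtain ⟨γ₀, hγ₀, rfl⟩ := (mem_ratPoints_iff _ _).1 hγ
    have key : ∀ η, Matrix.GeneralLinearGroup.map ι γ₀ * (s η)⁻¹ ∈ ratPoints (tailUnipotent n K (d - 1)) ↔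
        γ₀ * (lowCornerGL (n := n) (R := K) d (Bc η))⁻¹ ∈ tailUnipotent n K (d - 1) := by
      intro η
      rw [hs]
      change Matrix.GeneralLinearGroup.map ι γ₀ * (Matrix.GeneralLinearGroup.map ι _)⁻¹ ∈ _ ↔ _
      rw [← map_inv, ← map_mul]
      exact Subgroup.mem_map_iff_mem generalLinearGroup_map_algebraMap_injective
    obtain ⟨η₀, hη₀, huniq⟩ := existsUnique_mul_inv_lowCornerGL_mem hd0 hdn Bc (lowRow_lowCornerChoice hd0 hdn) hγ₀
    exact ⟨η₀, (key η₀).2 hη₀, fun η hη => huniq η ((key η).1 hη)⟩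
  haveI : Countable {η : ColIdx n d → K // η ≠ 0} := by
    haveI : Countable K := NumberField.countable' (K := K)
    infer_instance
  have hF'm : Measurable (towerFun (d - 1) φ w) := measurable_towerFun _ hφ hw
  have hF'inv : ∀ γ ∈ ratPoints (tailUnipotent n K (d - 1)), ∀ x,
      towerFun (d - 1) φ w (γ • x) = towerFun (d - 1) φ w x := fun γ hγ x =>
    towerFun_ratPoints_mul (by omega) hφK hwK ⟨γ, hγ⟩ x
  have step1 := lintegral_mul_eq_lintegral_tsum_mul ν (ratPoints (tailUnipotent n K d))
    (ratPoints (tailUnipotent n K (d - 1))) (ratPoints_mono (tailUnipotent_mono (by omega)))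
    hF'm hF'inv hβ'm hβ' hβm hβ hsΓ hsU
  rw [step1]
  -- Step 2: the pointwise Bessel bound, times `w β`
  have step2 : ∀ x, (∑' η, towerFun (d - 1) φ w (s η • x)) * β x ≤
      (w x * (V⁻¹ * ∫⁻ y in box, ENNReal.ofReal (‖whittakerDepth d φ ((y : GL (Fin n) (AdeleRing (𝓞 K) K)) * x)‖ ^ 2) ∂μ)) * β x := by
    intro x
    gcongr
    have hws : ∀ η, w (s η * x) = w x := fun η =>
      hwK _ (tailUnipotent_mono (by omega) (cornerGL_le_tailUnipotent d (lowCornerGL_mem_cornerGL d (Bc η)))) x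
    calc ∑' η, towerFun (d - 1) φ w (s η • x)
        = ∑' η, ENNReal.ofReal (‖whittakerDepth (d - 1) φ (s η * x)‖ ^ 2) * w x := by
          refine tsum_congr fun η => ?_
          rw [smul_eq_mul, towerFun, hws]
      _ = (∑' η, ENNReal.ofReal (‖whittakerDepth (d - 1) φ (s η * x)‖ ^ 2)) * w x := ENNReal.tsum_mul_right
      _ ≤ (V⁻¹ * ∫⁻ y in box, ENNReal.ofReal (‖whittakerDepth d φ ((y : GL (Fin n) (AdeleRing (𝓞 K) K)) * x)‖ ^ 2) ∂μ) * w x := by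
          gcongr
          exact tsum_sq_whittakerDepth_pred_le hφ hφK hd hd0 Bc (lowRow_lowCornerChoice hd0 hdn) x
      _ = _ := mul_comm _ _
  refine (lintegral_mono step2).trans (le_of_eq ?_)
  -- Step 3: exchange, substitute `x ↦ y⁻¹ x`, and recognise the `Y`-average of `β`
  have hHm : Measurable fun g : GL (Fin n) (AdeleRing (𝓞 K) K) => ENNReal.ofReal (‖whittakerDepth d φ g‖ ^ 2) := ENNReal.measurable_ofReal.comp ((continuous_whittakerDepth hφ d).norm.pow 2).measurable
  have hcont_yx : Continuous fun p : GL (Fin n) (AdeleRing (𝓞 K) K) × ↥Y => (p.2 : GL (Fin n) (AdeleRing (𝓞 K) K)) * p.1 :=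
    (continuous_subtype_val.comp continuous_snd).mul continuous_fst
  have hcont_yinvx : Continuous fun p : GL (Fin n) (AdeleRing (𝓞 K) K) × ↥Y => ((p.2 : GL (Fin n) (AdeleRing (𝓞 K) K)))⁻¹ * p.1 :=
    ((continuous_subtype_val.comp continuous_snd).inv).mul continuous_fst
  -- (a) rearrange the integrand and pull out `V⁻¹`
  have hmI : Measurable fun x : GL (Fin n) (AdeleRing (𝓞 K) K) =>
      ∫⁻ y in box, ENNReal.ofReal (‖whittakerDepth d φ ((y : GL (Fin n) (AdeleRing (𝓞 K) K)) * x)‖ ^ 2) ∂μ :=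
    ((hHm.comp hcont_yx.measurable) : Measurable (Function.uncurry fun (x : GL (Fin n) (AdeleRing (𝓞 K) K)) (y : ↥Y) =>
      ENNReal.ofReal (‖whittakerDepth d φ ((y : GL (Fin n) (AdeleRing (𝓞 K) K)) * x)‖ ^ 2))).lintegral_prod_right'
  have ha : ∀ x, w x * (V⁻¹ * ∫⁻ y in box, ENNReal.ofReal (‖whittakerDepth d φ ((y : GL (Fin n) (AdeleRing (𝓞 K) K)) * x)‖ ^ 2) ∂μ) * β x =
      V⁻¹ * ((∫⁻ y in box, ENNReal.ofReal (‖whittakerDepth d φ ((y : GL (Fin n) (AdeleRing (𝓞 K) K)) * x)‖ ^ 2) ∂μ) * (w x * β x)) := fun x => by ring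
  simp_rw [ha]
  have hm1 : Measurable fun x : GL (Fin n) (AdeleRing (𝓞 K) K) =>
      (∫⁻ y in box, ENNReal.ofReal (‖whittakerDepth d φ ((y : GL (Fin n) (AdeleRing (𝓞 K) K)) * x)‖ ^ 2) ∂μ) * (w x * β x) :=
    hmI.mul (hw.mul hβm)
  rw [lintegral_const_mul _ hm1]
  -- (b) `∫_x (∫_{box} H(yx) dy) (w β)(x) = ∫_{box} ∫_x H(yx) (wβ)(x)` (Tonelli)
  have hb : ∫⁻ x, (∫⁻ y in box, ENNReal.ofReal (‖whittakerDepth d φ ((y : GL (Fin n) (AdeleRing (𝓞 K) K)) * x)‖ ^ 2) ∂μ) * (w x * β x) ∂ν =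
      ∫⁻ y in box, ∫⁻ x, ENNReal.ofReal (‖whittakerDepth d φ ((y : GL (Fin n) (AdeleRing (𝓞 K) K)) * x)‖ ^ 2) * (w x * β x) ∂ν ∂μ := by
    have e1 : ∀ x, (∫⁻ y in box, ENNReal.ofReal (‖whittakerDepth d φ ((y : GL (Fin n) (AdeleRing (𝓞 K) K)) * x)‖ ^ 2) ∂μ) * (w x * β x) =
        ∫⁻ y in box, ENNReal.ofReal (‖whittakerDepth d φ ((y : GL (Fin n) (AdeleRing (𝓞 K) K)) * x)‖ ^ 2) * (w x * β x) ∂μ := fun x =>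
      (lintegral_mul_const _ (hHm.comp (continuous_subtype_val.mul continuous_const).measurable)).symm
    simp_rw [e1]
    refine lintegral_lintegral_swap ?_
    exact ((hHm.comp hcont_yx.measurable).mul ((hw.mul hβm).comp measurable_fst)).aemeasurable
  rw [hb]
  -- (c) substitute `x ↦ y⁻¹ x` in the inner integral and use the invariance of `w`
  have hc : ∀ y : ↥Y, ∫⁻ x, ENNReal.ofReal (‖whittakerDepth d φ ((y : GL (Fin n) (AdeleRing (𝓞 K) K)) * x)‖ ^ 2) * (w x * β x) ∂ν =
      ∫⁻ x, ENNReal.ofReal (‖whittakerDepth d φ x‖ ^ 2) * w x * β (((y : GL (Fin n) (AdeleRing (𝓞 K) K)))⁻¹ * x) ∂ν := by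
    intro y
    have e := lintegral_mul_left_eq_self (μ := ν)
      (fun x => ENNReal.ofReal (‖whittakerDepth d φ x‖ ^ 2) * w x * β (((y : GL (Fin n) (AdeleRing (𝓞 K) K)))⁻¹ * x)) (y : GL (Fin n) (AdeleRing (𝓞 K) K))
    rw [← e]
    refine lintegral_congr fun x => ?_
    simp only [inv_mul_cancel_left]
    rw [hwU _ (unipotentColRange_le_upperUnitriangular y.2) x]
    ring
  simp_rw [hc]
  -- (d) swap back and pull `H w` out of the `y`-integral
  have hd' : ∫⁻ y in box, ∫⁻ x, ENNReal.ofReal (‖whittakerDepth d φ x‖ ^ 2) * w x * β (((y : GL (Fin n) (AdeleRing (𝓞 K) K)))⁻¹ * x) ∂ν ∂μ =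
      ∫⁻ x, ENNReal.ofReal (‖whittakerDepth d φ x‖ ^ 2) * w x * ∫⁻ y in box, β (((y : GL (Fin n) (AdeleRing (𝓞 K) K)))⁻¹ * x) ∂μ ∂ν := by
    rw [lintegral_lintegral_swap]
    · refine lintegral_congr fun x => ?_
      exact lintegral_const_mul _ (hβm.comp ((continuous_subtype_val.inv).mul continuous_const).measurable)
    · exact (((hHm.mul hw).comp measurable_snd).mul (hβm.comp
        (((continuous_subtype_val.comp continuous_fst).inv).mul continuous_snd).measurable)).aemeasurable
  have hm2 : Measurable fun x : GL (Fin n) (AdeleRing (𝓞 K) K) =>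
      ENNReal.ofReal (‖whittakerDepth d φ x‖ ^ 2) * w x * ∫⁻ y in box, β (((y : GL (Fin n) (AdeleRing (𝓞 K) K)))⁻¹ * x) ∂μ :=
    (hHm.mul hw).mul
      ((hβm.comp hcont_yinvx.measurable : Measurable (Function.uncurry fun (x : GL (Fin n) (AdeleRing (𝓞 K) K)) (y : ↥Y) =>
        β (((y : GL (Fin n) (AdeleRing (𝓞 K) K)))⁻¹ * x))).lintegral_prod_right')
  rw [hd', ← lintegral_const_mul _ hm2]
  -- (e) recognise `towerFun d` times the `Y`-average of `β`, and apply (♠)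
  have he : ∀ x, V⁻¹ * (ENNReal.ofReal (‖whittakerDepth d φ x‖ ^ 2) * w x * ∫⁻ y in box, β (((y : GL (Fin n) (AdeleRing (𝓞 K) K)))⁻¹ * x) ∂μ) =
      towerFun d φ w x * boxAverage (K := K) d β x := fun x => by
    unfold towerFun boxAverage
    ring
  simp_rw [he]
  exact lintegral_mul_boxAverage_eq hd hd0 ν (measurable_towerFun d hφ hw)
    (fun p x => by
      obtain ⟨p₀, hp₀, hp₀e⟩ := (mem_ratPoints_iff _ _).1 p.2
      obtain ⟨hpt, hpc⟩ := Subgroup.mem_inf.1 hp₀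
      unfold towerFun
      rw [← hp₀e, whittakerDepth_mul_left_of_mem hφK hd hpt hpc,
        hwK p₀ (tailUnipotent_mono (by omega) hpt) x])
    (fun u x => towerFun_colRange_mul hd hφK hwU u x) hβm hβ

/-- **Iteration: `I^{(d)} ≤ I^{(n-1)}`** for every `d ≤ n - 1`, given a measurable `Q_e(K)`-covering
weight `β e` for every depth `e`. [folklore] -/
theorem towerIntegral_le_top {φ : GL (Fin n) (AdeleRing (𝓞 K) K) → ℂ} (hφ : Continuous φ)
    (hφK : ∀ (γ₀ : GL (Fin n) K) (x : GL (Fin n) (AdeleRing (𝓞 K) K)),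
      φ (Matrix.GeneralLinearGroup.map (algebraMap K (AdeleRing (𝓞 K) K)) γ₀ * x) = φ x)
    {w : GL (Fin n) (AdeleRing (𝓞 K) K) → ℝ≥0∞} (hw : Measurable w)
    (hwU : ∀ u : GL (Fin n) (AdeleRing (𝓞 K) K), u ∈ upperUnitriangular (Fin n) (AdeleRing (𝓞 K) K) → ∀ x, w (u * x) = w x)
    (hwK : ∀ γ₀ : GL (Fin n) K, γ₀ ∈ tailUnipotent n K (n - 1) →
      ∀ x, w (Matrix.GeneralLinearGroup.map (algebraMap K (AdeleRing (𝓞 K) K)) γ₀ * x) = w x)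
    (ν : Measure (GL (Fin n) (AdeleRing (𝓞 K) K))) [SFinite ν] [ν.IsMulLeftInvariant]
    {β : ℕ → GL (Fin n) (AdeleRing (𝓞 K) K) → ℝ≥0∞} (hβm : ∀ e, Measurable (β e))
    (hβ : ∀ e x, coveringSum ↥(ratPoints (tailUnipotent n K e)) (β e) x = 1) :
    ∀ (k d : ℕ), d + k = n - 1 →
      ∫⁻ x, towerFun d φ w x * β d x ∂ν ≤ ∫⁻ x, towerFun (n - 1) φ w x * β (n - 1) x ∂ν
  | 0, d, h => by rw [show d = n - 1 by omega]
  | k + 1, d, h => by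
    have hd : d + 1 < n := by omega
    have step := towerIntegral_pred_le hφ hφK hw hwU hwK ν hd (Nat.succ_pos d) (hβm (d + 1)) (hβ (d + 1))
      (hβm d) (hβ d)
    exact step.trans (towerIntegral_le_top hφ hφK hw hwU hwK ν hβm hβ k (d + 1) (by omega))

/-- **The bottom of the tower is dominated by the top**:
`∫ ‖Φ_0‖² w β_0 dν ≤ ∫ ‖φ‖² w β_{n-1} dν` (`Φ_0 = W_φ` the Whittaker transform, `Φ_{n-1} = φ`), the
inequality `Ψ(σ; W_φ, W_φ, Φ) ≤ ∫_{P_n(K) \ GL_n(𝔸)} |φ|² Φ(e_n g) |det g|^σ` of the real-point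
Rankin–Selberg method in covering-weight form (Jacquet–Shalika (1981), §4). [folklore] -/
theorem towerIntegral_zero_le {φ : GL (Fin n) (AdeleRing (𝓞 K) K) → ℂ} (hφ : Continuous φ)
    (hφK : ∀ (γ₀ : GL (Fin n) K) (x : GL (Fin n) (AdeleRing (𝓞 K) K)),
      φ (Matrix.GeneralLinearGroup.map (algebraMap K (AdeleRing (𝓞 K) K)) γ₀ * x) = φ x)
    {w : GL (Fin n) (AdeleRing (𝓞 K) K) → ℝ≥0∞} (hw : Measurable w)
    (hwU : ∀ u : GL (Fin n) (AdeleRing (𝓞 K) K), u ∈ upperUnitriangular (Fin n) (AdeleRing (𝓞 K) K) → ∀ x, w (u * x) = w x)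
    (hwK : ∀ γ₀ : GL (Fin n) K, γ₀ ∈ tailUnipotent n K (n - 1) →
      ∀ x, w (Matrix.GeneralLinearGroup.map (algebraMap K (AdeleRing (𝓞 K) K)) γ₀ * x) = w x)
    (ν : Measure (GL (Fin n) (AdeleRing (𝓞 K) K))) [SFinite ν] [ν.IsMulLeftInvariant]
    {β : ℕ → GL (Fin n) (AdeleRing (𝓞 K) K) → ℝ≥0∞} (hβm : ∀ e, Measurable (β e))
    (hβ : ∀ e x, coveringSum ↥(ratPoints (tailUnipotent n K e)) (β e) x = 1) :
    ∫⁻ x, towerFun 0 φ w x * β 0 x ∂ν ≤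
      ∫⁻ x, ENNReal.ofReal (‖φ x‖ ^ 2) * w x * β (n - 1) x ∂ν := by
  have h := towerIntegral_le_top hφ hφK hw hwU hwK ν hβm hβ (n - 1) 0 (by omega)
  have e : ∀ x, towerFun (n - 1) φ w x = ENNReal.ofReal (‖φ x‖ ^ 2) * w x := fun x => by
    unfold towerFun; rw [whittakerDepth_top]
  simp_rw [e] at h
  exact h

end Chain

end Literature.NumberTheory.Automorphic
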